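import Summits.MatrixMultiplication.MatrixMultiplication.Theses.ShapeSubmodularity
import Summits.MatrixMultiplication.MatrixMultiplication.Theses.EPRFaces
import Literature.Computability.AlgebraicComplexity.SchoenhageExample
import Literature.Computability.AlgebraicComplexity.SchonhageRectangular
import Literature.Computability.AlgebraicComplexity.AsymptoticRankBorderRank
import Literature.Computability.AlgebraicComplexity.RectangularExponentAsymptoticRank
import Literature.Barriers.MatrixMultiplication.RectangularBarrier

/-!
# Line `schoenhage` for crux `PerfectAmortisation` (E) — stmt-MatrixMultiplication-10893

ALTERNATIVE line (strategist, `--alt`; the live skeleton `Lines/birth.lean` is untouched).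

The crux (routes EPRFaces rank 2 / ShapeSubmodularity rank 3; the two decls are the same term):

  `E : ∀ ε > 0, ∃ k ≥ 1, R(⟨n, n, n^k⟩) = O(n^{k+1+ε})`   (`inf_k [ω(1,1,k) − k − 1] = 0`).

LINE = the PRE-LASER proof (Schönhage 1981 technology, the tool of Coppersmith 1982 /
Lotti–Romani 1983 Prop. 4.1, which predate Strassen's laser method by four years): no
Coppersmith–Winograd tensor, no Salem–Spencer set, no free diagonal, no typed supports.

Carrier: SCHÖNHAGE'S EXAMPLE `T_n := ⟨n,1,n⟩ ⊕ ⟨1,(n−1)²,1⟩` (BCS 1997 (15.12); tree: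
`matMulDirectSum ℂ ![n,1] ![1,(n-1)*(n-1)] ![n,1]`, whose border rank is `n² + 1` — one more than
the border rank `n²` of its first block: the second, LONG block `⟨1,(n−1)²,1⟩` rides almost for free.
Because `T_n` is already a DIRECT SUM of matrix tensors, its Kronecker powers need no laser: the
binomial expansion `T_n^{⊗r} = ⊕_words` contains, among the words with exactly ONE letter
`⟨n,1,n⟩` and `r − 1` letters `⟨1,(n−1)²,1⟩`, the multiple

  `T_n^{⊗r} ≥ ⟨r⟩ ⊗ ⟨n, (n−1)^{2(r−1)}, n⟩ ≥ ⟨r⟩ ⊗ ⟨n−1, (n−1)^{2(r−1)}, n−1⟩`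

(restriction; shrinking `n → n−1` in the two short slots makes the long slot an EXACT power
`a^k`, `a = n − 1`, `k = 2(r−1)`).  Schönhage's rectangular asymptotic sum inequality in the
middle-slot form (tree: `mul_rpow_omegaRect_mid_le_asymptoticRank`) and `R̃ ≤ R̲` (tree:
`asymptoticRank_le_of_algBorderRank_le`) give, for all `n ≥ 3`, `r ≥ 1`,

  `r · (n−1)^{ω(1,1,2r−2)} ≤ R̃(T_n)^r ≤ (n² + 1)^r`,  i.e.
  `ω(1,1,2r−2) ≤ (r·log(n²+1) − log r) / log(n−1)`,

and along `r = n → ∞` the excess `ω(1,1,2n−2) − (2n−1)` is `≤ 2/log n + O(1/(n log n)) → 0`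
(numerically 0.957, 0.437, 0.290, 0.220, 0.145 at `n = 10, 10², 10³, 10⁴, 10⁶`; the optimum
`r ≈ n/2` gives `(1 + log 2)/log n`).  Hence E.

STUBS (each a genuine lemma of the line; none restates E, `ω = 2`, or a refuted statement):
* `stub_schoenhageBound` — BCS (15.12), upper bound: `R̲(⟨e,1,ℓ⟩ ⊕ ⟨1,(e−1)(ℓ−1),1⟩) ≤ eℓ + 1`
  over `ℂ`, `e, ℓ ≥ 2` — the explicit order-3 degeneration of BCS §15.4 p. 422
  (`∑_{ij} (aᵢ + εXᵢⱼ)(bⱼ + εYᵢⱼ)(ε²cⱼᵢ + Z) − (∑aᵢ)(∑bⱼ)Z = ε²(⟨e,1,ℓ⟩ ⊕ ⟨1,h,1⟩) + O(ε³)`, with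
  `X_{ej} := −∑_{i<e} Xᵢⱼ`, `X_{iℓ} := 0`, `Y_{iℓ} := −∑_{j<ℓ} Yᵢⱼ`, `Y_{ej} := 0`); this is the
  body of the tree's NAMED FACT `BCS1997_schoenhageExample` at `K = ℂ` (unproved in the tree; the
  lower bound `schoenhageExample_ge` is proved).  Size M–L (an `IsApproxDecomposition` of order 2
  with `eℓ + 1` explicit polynomial triads, degree ≤ 2 in `ε`).
* `stub_oneLetterWords` — first-order term of the binomial expansion: for `T = ⟨e,1,ℓ⟩ ⊕ ⟨1,h,1⟩`
  and `r ≥ 1`, `T^{⊗r} ≥ ⟨r⟩ ⊗ ⟨e, h^{r−1}, ℓ⟩` (restriction to the `r` words with exactly one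
  letter `0`; tree: `tensorRestrictsTo_kroneckerPow_matMulDirectSum_words` + the equal-format
  sub-sum relabelling of `tensorRank_multiple_le_kroneckerPow_matMulDirectSum`, as a restriction).
  Size M.
* `stub_schoenhageRate` — the parameter choice: `∀ ε > 0 ∃ n ≥ 3, r ≥ 2` with
  `r·log(n²+1) − log r < (2r − 1 + ε)·log(n−1)` (e.g. `r = n > exp(4/ε)`: `log(n²+1) ≤ 2 log n + n⁻²`,
  `log(n−1) ≥ log n − 1/(n−1)`).  Size M (Mathlib real analysis only; no entropy function).
ASSEMBLY (sorry-free below): `mul_rpow_omegaRect_le_of_schoenhage` (the displayed chain),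
`omegaRect_le_of_schoenhage` (take logarithms), `isBigO_of_omegaRect_lt` (dictionary
`ω(1,1,k) < β` ⇒ rank-form O-bound at the natural exponent `k`), `PerfectAmortisation_of`,
`PerfectAmortisation_proof` (EPRFaces decl, BY NAME) and `_proof_shapeSubmodularity`.

WHY IT DODGES THE STUCK GOAL OF `birth`: `birth`'s load-bearing stub `stub_cwLaserPacking` is the
laser method on `CW_q^{⊗N}` in a rectangular weighting (typed supports, Salem–Spencer free
diagonal, entropy of one binomial; ≈ 600–900 lines by its own card).  Here the carrier is a direct
sum, so "packing" is the `r` one-letter words (no hashing at all), and the rate stub has no entropy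
term.  The price is `stub_schoenhageBound` (an explicit `(eℓ+1)`-term polynomial identity), which
`birth` gets for free from the tree's proved `asymptoticRank_bigCwTensor_le`.

DISPROOF USED: none — no `Disproof.lean` is registered for this crux (`ledger crux ls`, 2026-08-17).
BARRIERS: `RectangularBarrier` (CLLZ Thm 3.15) concerns T-method proofs through `CW_q`; this line
does not touch `CW_q`.  `UniversalMethodBarrier` / `IrreversibilityBarrier` price SQUARE `ω` from a
fixed carrier; here the carrier `T_n` varies with `n → ∞` and the target is the far-rectangular
normalisation `ω(1,1,k) − k`, on which they are silent.  `InfimumNotMinimumBarrier` respected (strict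
`<` with slack `ε`, no single format certifies the infimum).  Negatives index (STPP/design side)
untouched.
-/

namespace Summit.MatrixMultiplication.MatrixMultiplication.Cruxes.PerfectAmortisation.Schoenhage

open Literature.Computability.AlgebraicComplexity
open Literature.Barriers.MatrixMultiplication
open Filter Asymptotics

/-- **Stub 1 (Schönhage's example, the upper bound; BCS 1997 (15.12), proof §15.4 p. 422).**
For `e, ℓ ≥ 2`: `R̲(⟨e,1,ℓ⟩ ⊕ ⟨1,(e−1)(ℓ−1),1⟩) ≤ eℓ + 1` over `ℂ` (`algBorderRank` over `ℂ[ε]`,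
`matMulDirectSum` spelling of `SchoenhageExample.lean`; the body of the named fact
`BCS1997_schoenhageExample` at `K = ℂ`).  Witness: the `eℓ + 1` triads
`(aᵢ + εXᵢⱼ) ⊗ (bⱼ + εYᵢⱼ) ⊗ (ε²cⱼᵢ + Z)` (`i ≤ e`, `j ≤ ℓ`, with the linear substitutions
`X_{ej} = −∑_{i<e} Xᵢⱼ`, `X_{iℓ} = 0`, `Y_{iℓ} = −∑_{j<ℓ} Yᵢⱼ`, `Y_{ej} = 0`) and
`−(∑aᵢ) ⊗ (∑bⱼ) ⊗ Z`, an approximate decomposition of order `2`. -/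
theorem stub_schoenhageBound :
    ∀ e l : ℕ, 2 ≤ e → 2 ≤ l →
      algBorderRank (matMulDirectSum ℂ ![e, 1] ![1, (e - 1) * (l - 1)] ![l, 1]) ≤ e * l + 1 := by
  sorry

/-- **Stub 2 (one-letter words of a power of a two-block direct sum).**  For
`T = ⟨e,1,ℓ⟩ ⊕ ⟨1,h,1⟩` and `r ≥ 1`, the `r`-th Kronecker power of `T` restricts to `r`
independent copies of `⟨e, h^{r−1}, ℓ⟩ = ⟨e,1,ℓ⟩ ⊗ ⟨1,h,1⟩^{⊗(r−1)}` — the blocks of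
`T^{⊗r} = ⊕_{w ∈ {0,1}^r} ⟨∏ k_{w_j}, ∏ m_{w_j}, ∏ n_{w_j}⟩` indexed by the `r` words with exactly
one letter `0` (Bläser 2013, proof of Thm. 7.5; BCS (15.11) proof).  Tree:
`tensorRestrictsTo_kroneckerPow_matMulDirectSum_words`, then relabel the equal-format sub-sum as
in `tensorRank_multiple_le_kroneckerPow_matMulDirectSum` (with `tensorRestrictsTo_precomp`). -/
theorem stub_oneLetterWords :
    ∀ e h l r : ℕ, 1 ≤ r →
      TensorRestrictsTo (kroneckerPow (matMulDirectSum ℂ ![e, 1] ![1, h] ![l, 1]) r)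
        (kroneckerTensor (unitTensor ℂ r) (matMulTensor ℂ e (h ^ (r - 1)) l)) := by
  sorry

/-- **Stub 3 (the rate: Schönhage's family has vanishing amortisation excess).**  For every
`ε > 0` some `n ≥ 3`, `r ≥ 2` satisfy `r·log(n²+1) − log r < (2r − 1 + ε)·log(n − 1)`; e.g.
`r = n` with `ε·log n > 4` (`log(n²+1) ≤ 2 log n + n⁻²`, `log(n−1) ≥ log n − (n−1)⁻¹`, so the
excess of the quotient over `2n − 1` is `≤ 2/log n + 3/(n log n)`). -/
theorem stub_schoenhageRate :
    ∀ ε : ℝ, 0 < ε → ∃ n r : ℕ, 3 ≤ n ∧ 2 ≤ r ∧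
      (r : ℝ) * Real.log ((n : ℝ) ^ 2 + 1) - Real.log (r : ℝ) <
        (2 * (r : ℝ) - 1 + ε) * Real.log ((n : ℝ) - 1) := by
  sorry

/-! ## Assembly (sorry-free) -/

/-- The Schönhage chain: for `n ≥ 3`, `r ≥ 1`, with `a = n − 1`, `k = 2(r − 1)`,
`r · a^{ω(1,1,k)} ≤ R̃(⟨r⟩ ⊗ ⟨a, a^k, a⟩) ≤ R̃(⟨r⟩ ⊗ ⟨n, (n−1)^{2(r−1)}, n⟩) ≤ R̃(T_n^{⊗r})
≤ R̃(T_n)^r ≤ R̲(T_n)^r ≤ (n² + 1)^r`. -/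
theorem mul_rpow_omegaRect_le_of_schoenhage
    (h1 : ∀ e l : ℕ, 2 ≤ e → 2 ≤ l →
      algBorderRank (matMulDirectSum ℂ ![e, 1] ![1, (e - 1) * (l - 1)] ![l, 1]) ≤ e * l + 1)
    (h2 : ∀ e h l r : ℕ, 1 ≤ r →
      TensorRestrictsTo (kroneckerPow (matMulDirectSum ℂ ![e, 1] ![1, h] ![l, 1]) r)
        (kroneckerTensor (unitTensor ℂ r) (matMulTensor ℂ e (h ^ (r - 1)) l)))
    {n r : ℕ} (hn : 3 ≤ n) (hr : 1 ≤ r) :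
    (r : ℝ) * ((n - 1 : ℕ) : ℝ) ^ omegaRect ℂ 1 1 ((2 * (r - 1) : ℕ) : ℝ) ≤
      ((n : ℝ) * n + 1) ^ r := by
  set a : ℕ := n - 1 with ha_def
  set k : ℕ := 2 * (r - 1) with hk_def
  set B : ℕ := a ^ k with hB_def
  set T := matMulDirectSum ℂ ![n, 1] ![1, (n - 1) * (n - 1)] ![n, 1] with hT
  have ha2 : 2 ≤ a := by omega
  have han : a ≤ n := by omega
  have ha0 : (0 : ℝ) < a := by exact_mod_cast (by omega : 0 < a)
  -- (1) rectangular asymptotic sum inequality, middle slot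
  have haB : (a : ℝ) ^ ((k : ℕ) : ℝ) ≤ (B : ℝ) := by
    rw [Real.rpow_natCast, hB_def, Nat.cast_pow]
  have hASI := mul_rpow_omegaRect_mid_le_asymptoticRank ℂ (k := ((k : ℕ) : ℝ)) (Nat.cast_nonneg k)
    hr ha2 haB
  rw [omegaRect_one_mid_one] at hASI
  -- (2) shrink the two short slots: ⟨r⟩ ⊗ ⟨n, B, n⟩ ≥ ⟨r⟩ ⊗ ⟨a, B, a⟩
  have hshrink : TensorRestrictsTo (kroneckerTensor (unitTensor ℂ r) (matMulTensor ℂ n B n))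
      (kroneckerTensor (unitTensor ℂ r) (matMulTensor ℂ a B a)) :=
    (TensorRestrictsTo.refl _).kronecker (tensorRestrictsTo_matMulTensor_of_le ℂ han le_rfl han)
  -- (3) the one-letter words of `T^{⊗r}`
  have hpow : ((n - 1) * (n - 1)) ^ (r - 1) = B := by
    rw [hB_def, hk_def, ha_def, pow_mul, sq]
  have hwords : TensorRestrictsTo (kroneckerPow T r)
      (kroneckerTensor (unitTensor ℂ r) (matMulTensor ℂ n B n)) := by
    have h := h2 n ((n - 1) * (n - 1)) n r hr
    rwa [hpow] at h
  have hdeg : asymptoticRank (kroneckerTensor (unitTensor ℂ r) (matMulTensor ℂ a B a)) ≤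
      asymptoticRank (kroneckerPow T r) :=
    asymptoticRank_le_of_polyDegeneratesTo (hwords.trans hshrink).polyDegeneratesTo
  -- (4) `R̃(T^{⊗r}) ≤ R̃(T)^r ≤ (n² + 1)^r`
  have hbr : asymptoticRank T ≤ ((n * n + 1 : ℕ) : ℝ) :=
    asymptoticRank_le_of_algBorderRank_le (h1 n n (by omega) (by omega))
  have hTpow : asymptoticRank (kroneckerPow T r) ≤ ((n : ℝ) * n + 1) ^ r := by
    refine (asymptoticRank_kroneckerPow_le T (by omega : 0 < r)).trans ?_
    refine pow_le_pow_left₀ (asymptoticRank_nonneg _) ?_ r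
    exact_mod_cast hbr
  exact hASI.trans (hdeg.trans hTpow)

/-- Taking logarithms: `ω(1,1,2(r−1)) ≤ (r·log(n²+1) − log r)/log(n−1)` for `n ≥ 3`, `r ≥ 1`. -/
theorem omegaRect_le_of_schoenhage
    (h1 : ∀ e l : ℕ, 2 ≤ e → 2 ≤ l →
      algBorderRank (matMulDirectSum ℂ ![e, 1] ![1, (e - 1) * (l - 1)] ![l, 1]) ≤ e * l + 1)
    (h2 : ∀ e h l r : ℕ, 1 ≤ r →
      TensorRestrictsTo (kroneckerPow (matMulDirectSum ℂ ![e, 1] ![1, h] ![l, 1]) r)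
        (kroneckerTensor (unitTensor ℂ r) (matMulTensor ℂ e (h ^ (r - 1)) l)))
    {n r : ℕ} (hn : 3 ≤ n) (hr : 1 ≤ r) :
    omegaRect ℂ 1 1 ((2 * (r - 1) : ℕ) : ℝ) ≤
      ((r : ℝ) * Real.log ((n : ℝ) ^ 2 + 1) - Real.log (r : ℝ)) / Real.log ((n : ℝ) - 1) := by
  set ω₀ : ℝ := omegaRect ℂ 1 1 ((2 * (r - 1) : ℕ) : ℝ) with hω
  have h := mul_rpow_omegaRect_le_of_schoenhage h1 h2 hn hr
  have hcast : ((n - 1 : ℕ) : ℝ) = (n : ℝ) - 1 := by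
    rw [Nat.cast_sub (by omega : 1 ≤ n), Nat.cast_one]
  rw [hcast] at h
  have ha1 : (1 : ℝ) < (n : ℝ) - 1 := by
    have : (3 : ℝ) ≤ n := by exact_mod_cast hn
    linarith
  have ha0 : (0 : ℝ) < (n : ℝ) - 1 := by linarith
  have hr0 : (0 : ℝ) < r := by exact_mod_cast (by omega : 0 < r)
  have hlog : (0 : ℝ) < Real.log ((n : ℝ) - 1) := Real.log_pos ha1
  have hsq : (n : ℝ) * n + 1 = (n : ℝ) ^ 2 + 1 := by ring
  rw [hsq] at h
  -- log of both sides
  have hpos : (0 : ℝ) < (r : ℝ) * ((n : ℝ) - 1) ^ ω₀ := by positivity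
  have hlogle := Real.log_le_log hpos h
  rw [Real.log_mul hr0.ne' (Real.rpow_pos_of_pos ha0 _).ne', Real.log_rpow ha0,
    Real.log_pow] at hlogle
  rw [le_div_iff₀ hlog]
  linarith

/-- Dictionary: a strict upper bound `ω(1,1,k) < β` at a natural exponent `k` is the rank-form
O-bound `R(⟨n, n, n^k⟩) = O(n^β)` (`⌈n^1⌉ = n`, `⌈n^k⌉ = n^k`, upward closure of admissible sets). -/
theorem isBigO_of_omegaRect_lt {k : ℕ} {β : ℝ} (h : omegaRect ℂ 1 1 (k : ℝ) < β) :
    (fun n : ℕ => (tensorRank (matMulTensor ℂ n n (n ^ k)) : ℝ)) =O[atTop]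
      fun n : ℕ => (n : ℝ) ^ β := by
  have hne := rectAdmissibleExponents_nonempty ℂ 1 1 (k : ℝ)
  unfold omegaRect at h
  obtain ⟨β', hβ', hlt⟩ := exists_lt_of_csInf_lt hne h
  have hβ : β ∈ rectAdmissibleExponents ℂ 1 1 (k : ℝ) :=
    mem_rectAdmissibleExponents_of_le hβ' hlt.le
  have hfun : (fun n : ℕ => (tensorRank (matMulTensor ℂ n n (n ^ k)) : ℝ)) =
      fun n : ℕ =>
        (tensorRank (matMulTensor ℂ (rectDim n 1) (rectDim n 1) (rectDim n (k : ℝ))) : ℝ) := by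
    funext n
    rw [tensorRank_matMulTensor_congr ℂ (rectDim_one n).symm (rectDim_one n).symm
      (rectDim_natCast n k).symm]
  rw [hfun]
  exact hβ

/-- **Assembly**: the three stubs imply the crux `PerfectAmortisation` BY NAME (route
ShapeSubmodularity spelling; the EPRFaces decl is the same term). -/
theorem PerfectAmortisation_of :
    (∀ e l : ℕ, 2 ≤ e → 2 ≤ l →
      algBorderRank (matMulDirectSum ℂ ![e, 1] ![1, (e - 1) * (l - 1)] ![l, 1]) ≤ e * l + 1) →
    (∀ e h l r : ℕ, 1 ≤ r →
      TensorRestrictsTo (kroneckerPow (matMulDirectSum ℂ ![e, 1] ![1, h] ![l, 1]) r)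
        (kroneckerTensor (unitTensor ℂ r) (matMulTensor ℂ e (h ^ (r - 1)) l))) →
    (∀ ε : ℝ, 0 < ε → ∃ n r : ℕ, 3 ≤ n ∧ 2 ≤ r ∧
      (r : ℝ) * Real.log ((n : ℝ) ^ 2 + 1) - Real.log (r : ℝ) <
        (2 * (r : ℝ) - 1 + ε) * Real.log ((n : ℝ) - 1)) →
    Summit.MatrixMultiplication.MatrixMultiplication.Theses.ShapeSubmodularity.PerfectAmortisation := by
  intro h1 h2 h3 ε hε
  obtain ⟨n, r, hn, hr, hlt⟩ := h3 ε hε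
  refine ⟨2 * (r - 1), by omega, ?_⟩
  have hω := omegaRect_le_of_schoenhage h1 h2 hn (by omega : 1 ≤ r)
  have ha1 : (1 : ℝ) < (n : ℝ) - 1 := by
    have : (3 : ℝ) ≤ n := by exact_mod_cast hn
    linarith
  have hlog : (0 : ℝ) < Real.log ((n : ℝ) - 1) := Real.log_pos ha1
  have hquot : ((r : ℝ) * Real.log ((n : ℝ) ^ 2 + 1) - Real.log (r : ℝ)) / Real.log ((n : ℝ) - 1)
      < 2 * (r : ℝ) - 1 + ε := by
    rw [div_lt_iff₀ hlog]
    exact hlt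
  have hk : (((2 * (r - 1) : ℕ)) : ℝ) = 2 * (r : ℝ) - 2 := by
    rw [Nat.cast_mul, Nat.cast_sub (by omega : 1 ≤ r)]
    push_cast
    ring
  have hωlt : omegaRect ℂ 1 1 (((2 * (r - 1) : ℕ)) : ℝ) < (((2 * (r - 1) : ℕ)) : ℝ) + 1 + ε := by
    rw [hk]
    have := hω.trans_lt hquot
    rw [hk] at this
    linarith
  exact isBigO_of_omegaRect_lt hωlt

/-- **Registered skeleton conclusion**: the crux BY NAME — the item's primary decl
`EPRFaces.PerfectAmortisation` (route EPRFaces, rank 2) — from the three stubs.  The only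
`sorry`s of the file sit inside `stub_schoenhageBound`, `stub_oneLetterWords`,
`stub_schoenhageRate`. -/
theorem PerfectAmortisation_proof :
    Summit.MatrixMultiplication.MatrixMultiplication.Theses.EPRFaces.PerfectAmortisation :=
  PerfectAmortisation_of stub_schoenhageBound stub_oneLetterWords stub_schoenhageRate

/-- The same conclusion under the sharing route's name `ShapeSubmodularity.PerfectAmortisation`
(route-MatrixMultiplication-ShapeSubmodularity, rank 3; the two decls are the same term). -/
theorem PerfectAmortisation_proof_shapeSubmodularity :
    Summit.MatrixMultiplication.MatrixMultiplication.Theses.ShapeSubmodularity.PerfectAmortisation :=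
  PerfectAmortisation_of stub_schoenhageBound stub_oneLetterWords stub_schoenhageRate

end Summit.MatrixMultiplication.MatrixMultiplication.Cruxes.PerfectAmortisation.Schoenhage
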